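import Summits.QuantumFields.BalabanUV.Beta.FP.PerfectMaxwellDictParseval
import Summits.QuantumFields.BalabanUV.Beta.FP.AliasDecimateIntegrable
import Summits.QuantumFields.BalabanUV.Beta.FP.PerfectPropagatorSymbol

/-!
# `BalabanUV.Beta.FP.LatticeFormPlancherel` — road «FP» (binder row D1), row H′2-IR ∕ IR-3, sub-row «IR-3-ELL-OP», file 1∕2 (GENERIC):
# PARSEVAL FOR QUADRATIC FORMS OF TRANSLATION-INVARIANT LATTICE KERNELS ON FINITELY SUPPORTED FIELDS, and the MONOTONICITY
# «pointwise symbol inequality ⟹ form inequality» that turns a real-zone SYMBOL bound into an OPERATOR bound on `ℓ²`-finitely-supported fields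

[folklore] (Parseval on `ℤ^{d+1}` ↔ `[−π,π]^{d+1}`; not in print in this form; our bookkeeping for IR3-DESIGN l.30 «all operators coarse-translation
invariant ⟹ symbol inequality», the ⟸ direction).  Pattern and letters BY NAME: `B4ContourShift.latticeKernel` (`K_G(x) = (2π)^{−(d+1)}∫_{BZ} G(p)e^{ip·x}dp`),
`B5Momentum166Zd.FT` (window transform `f̃(s) = Σ_{y∈S} f(y)e^{−is·y}`), gan24-leaf-02-g34's `PerfectMaxwellDictPlancherel` (`conj_FT`, `cexp_phase_sub`,
`sum_swap4`, `integral_sum4`) and `PerfectMaxwellDictParseval.d1Sym_mul_FT` (transform of the unit forward difference), leaf-02-g7's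
`AliasDecimateIntegrable.integrableOn_integrand_of_integrableOn` (an `L¹` zone symbol has integrable phase-weighted integrands).

## What is proved (`0 sorry`, every `d`; `S ⊆ T` finite windows, real fields)
* §1 `quad_mul_left` (`quad M (c·v) = ‖c‖²·quad M v`), `sum_integrand_eq_quad` (the quadruple window sum at fixed momentum is `quad (A(s)) (F̃(s))`),
  `sum_integrand_scalar_eq` (scalar twin: `Σ_{x,y} f x g y·b(s)e^{is·(x−y)} = b(s)·conj f̃(s)·g̃(s)`).
* §2 **`form_latticeKernel_eq_integral`** — for a matrix multiplier `A` with `L¹` zone entries and a real bond field `F` on `S`: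
  `Σ_{x,y∈S} Σ_{α,β} F(x,α)·K_{A_{αβ}}(x−y)·F(y,β) = (2π)^{−(d+1)} ∫_{BZ} quad (A(s)) (F̃(s)) ds`;
  **`form_scalar_eq_integral`** — `Σ_{x,y∈S} f(x)·K_b(x−y)·g(y) = (2π)^{−(d+1)} ∫_{BZ} b(s)·conj f̃(s)·g̃(s) ds`.
* §3 **`form_diff_eq_integral`** — with `F := d^cφ` (`F(x,μ) = φ(x+e_μ) − φ(x)`, `φ` supported in `S`, window `T ⊇ S ∪ ⋃_μ(S − e_μ)`):
  `Σ_{x,y∈T} Σ_{μν} (d^cφ)(x,μ)·K_{A_{μν}}(x−y)·(d^cφ)(y,ν) = (2π)^{−(d+1)} ∫_{BZ} ‖φ̃(s)‖²·quad (A(s)) (d1Sym s) ds`.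
* §4 real parts: `re_form_scalar_eq_integral`, `re_form_diff_eq_integral`, and **`form_diff_ge_of_symbol`** — if `c·Re b(s) ≤ Re quad (A(s)) (d1Sym s)`
  for every `s ∈ BZ ∖ {0}`, then `c·Σ_{x,y} φ(x)·Re K_b(x−y)·φ(y) ≤ Σ_{x,y} Σ_{μν} (d^cφ)(x,μ)·Re K_{A_{μν}}(x−y)·(d^cφ)(y,ν)` for every real `φ`
  supported in `S` (a null set is discarded; integrability: `A`, `b`, `quad (A ·)(d1Sym ·)` in `L¹(BZ)`).
HONEST FRAMING: generic Fourier bookkeeping; 0 objects of Bałaban; 0 estimates; 0∕4 row-D1 binders; NOT D1, NOT BetaPertH, NOT the continuum limit, NOT Clay.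
HONEST DEPENDENCY (verbatim): «continuum YM on T⁴ ⇐ BetaPertH ∧ nine spine estimates (0/9 proved); BetaPertH ⇐ (D1) ∧ (D4) ∧ CAP+tail; G-an2-4 gates asym, D1 and NE2/3/4.»
ABSOLUTE RULE respected: no cited fact, no `def`, no `def … : Prop`, nothing of the manuscripts asserted.
Provenance: D1 formalisation swarm leaf prover 02, gen 7 (prover-b2b-balaban-beta-d1-formalise-leaf-02-g7-0), road-FP «IR-3-ELL-OP» INTENT (journal l.22844), 2026-08-20.
-/

noncomputable section

open Complex Finset Matrix MeasureTheory
open scoped Real BigOperators ComplexConjugate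
open Literature.MathematicalPhysics.QuantumFieldTheory.Balaban1983to89
open B4Strip (ofRealVec)
open B4ContourShift (BZ integrand fourierBox latticeKernel)
open B5Prop11Fiber (d1Sym)
open B5Ineq167SymbolZd (phase phase_sub)
open B6QGQLower276 (X e)
open B5Momentum166Zd (FT phaseC_eq continuous_phase isCompact_BZ measurableSet_BZ)
open Summit.QuantumFields.BalabanUV.Beta.FP.PerfectPropagatorSymbol (quad)
open Summit.QuantumFields.BalabanUV.Beta.FP.PerfectMaxwellDictPlancherel (cexp_phase_sub conj_FT sum_swap4 integral_sum4)
open Summit.QuantumFields.BalabanUV.Beta.FP.PerfectMaxwellDictParseval (d1Sym_mul_FT)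
open Summit.QuantumFields.BalabanUV.Beta.FP.AliasDecimateIntegrable (integrableOn_integrand_of_integrableOn)

namespace Summit.QuantumFields.BalabanUV.Beta.FP.LatticeFormPlancherel

variable {d : ℕ}

/-! ## §1 Fixed-momentum algebra -/

/-- [folklore] A scalar comes out of the quadratic form with its squared modulus: `quad M (λ β, c·v β) = ‖c‖²·quad M v`. -/
theorem quad_mul_left {ι : ℕ} (M : Matrix (Fin ι) (Fin ι) ℂ) (c : ℂ) (v : Fin ι → ℂ) :
    quad M (fun β => c * v β) = ((‖c‖ ^ 2 : ℝ) : ℂ) * quad M v := by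
  unfold quad
  rw [Finset.mul_sum]
  refine Finset.sum_congr rfl fun α _ => ?_
  rw [Finset.mul_sum]
  refine Finset.sum_congr rfl fun β _ => ?_
  rw [map_mul, Complex.ofReal_pow, ← Complex.conj_mul' c]
  ring

/-- [folklore] **THE QUADRUPLE WINDOW SUM AT A FIXED MOMENTUM IS THE QUADRATIC FORM OF THE SYMBOL MATRIX ON THE TRANSFORM**:
`Σ_{x,y∈S} Σ_{α,β} F(x,α)F(y,β)·A_{αβ}(s)e^{is·(x−y)} = quad (A(s)) (β ↦ F̃_β(s))`. -/
theorem sum_integrand_eq_quad (S : Finset (X (d + 1))) (F : X (d + 1) → Fin (d + 1) → ℝ)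
    (A : (Fin (d + 1) → ℂ) → Matrix (Fin (d + 1)) (Fin (d + 1)) ℂ) (s : Fin (d + 1) → ℝ) :
    ∑ x ∈ S, ∑ y ∈ S, ∑ α, ∑ β, ((F x α * F y β : ℝ) : ℂ) * integrand (fun p => A p α β) (x - y) s =
      quad (A (ofRealVec s)) (fun β => FT S (fun y => F y β) s) := by
  unfold quad
  have hR : ∀ α β, conj (FT S (fun y => F y α) s) * A (ofRealVec s) α β * FT S (fun y => F y β) s =
      ∑ x ∈ S, ∑ y ∈ S, ((F x α : ℂ) * cexp (I * B4ContourShift.phase s x)) * A (ofRealVec s) α β *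
        ((F y β : ℂ) * cexp (((-phase s y : ℝ) : ℂ) * I)) := by
    intro α β
    rw [conj_FT]
    unfold FT
    rw [Finset.sum_mul, Finset.sum_mul]
    refine Finset.sum_congr rfl fun x _ => ?_
    rw [Finset.mul_sum]
  simp_rw [hR]
  refine (sum_swap4 S _).trans (Finset.sum_congr rfl fun α _ => Finset.sum_congr rfl fun β _ =>
    Finset.sum_congr rfl fun x _ => Finset.sum_congr rfl fun y _ => ?_)
  simp only [integrand]
  rw [cexp_phase_sub]
  push_cast
  ring

/-- [folklore] Scalar twin: `Σ_{x,y∈S} f(x)g(y)·b(s)e^{is·(x−y)} = b(s)·conj f̃(s)·g̃(s)`. -/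
theorem sum_integrand_scalar_eq (S : Finset (X (d + 1))) (f g : X (d + 1) → ℝ) (b : (Fin (d + 1) → ℂ) → ℂ) (s : Fin (d + 1) → ℝ) :
    ∑ x ∈ S, ∑ y ∈ S, ((f x * g y : ℝ) : ℂ) * integrand b (x - y) s = b (ofRealVec s) * (conj (FT S f s) * FT S g s) := by
  rw [conj_FT]
  unfold FT
  rw [Finset.sum_mul, Finset.mul_sum]
  refine Finset.sum_congr rfl fun x _ => ?_
  rw [Finset.mul_sum, Finset.mul_sum]
  refine Finset.sum_congr rfl fun y _ => ?_
  simp only [integrand]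
  rw [cexp_phase_sub]
  push_cast
  ring

/-! ## §2 Parseval for the forms -/

/-- [folklore] **PARSEVAL, MATRIX MULTIPLIER**: for a matrix multiplier `A` with zone-integrable entries and a real bond field `F` read on the window `S`,
`Σ_{x,y∈S} Σ_{α,β} F(x,α)·K_{A_{αβ}}(x−y)·F(y,β) = (2π)^{−(d+1)}·∫_{BZ} quad (A(s)) (F̃(s)) ds`. -/
theorem form_latticeKernel_eq_integral (S : Finset (X (d + 1))) (F : X (d + 1) → Fin (d + 1) → ℝ)
    (A : (Fin (d + 1) → ℂ) → Matrix (Fin (d + 1)) (Fin (d + 1)) ℂ) (hA : ∀ α β, IntegrableOn (fun p => A (ofRealVec p) α β) (BZ (d + 1))) :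
    ∑ x ∈ S, ∑ y ∈ S, ∑ α, ∑ β, (F x α : ℂ) * latticeKernel (fun p => A p α β) (x - y) * (F y β : ℂ) =
      ((((2 * Real.pi) ^ (d + 1))⁻¹ : ℝ) : ℂ) * ∫ s in BZ (d + 1), quad (A (ofRealVec s)) (fun β => FT S (fun y => F y β) s) := by
  have h1 : ∀ x y α β, (F x α : ℂ) * latticeKernel (fun p => A p α β) (x - y) * (F y β : ℂ) =
      ((((2 * Real.pi) ^ (d + 1))⁻¹ : ℝ) : ℂ) *
        ∫ s in BZ (d + 1), ((F x α * F y β : ℝ) : ℂ) * integrand (fun p => A p α β) (x - y) s := by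
    intro x y α β
    rw [integral_const_mul]
    unfold latticeKernel fourierBox
    rw [Complex.real_smul]
    push_cast
    ring
  have hF : ∀ x y α β, IntegrableOn (fun s => ((F x α * F y β : ℝ) : ℂ) * integrand (fun p => A p α β) (x - y) s) (BZ (d + 1)) :=
    fun x y α β => (integrableOn_integrand_of_integrableOn (hA α β) (x - y)).const_mul _
  simp_rw [h1]
  simp only [← Finset.mul_sum]
  rw [← integral_sum4 hF]
  congr 1
  exact setIntegral_congr_fun measurableSet_BZ fun s _ => sum_integrand_eq_quad S F A s

/-- [folklore] **PARSEVAL, SCALAR MULTIPLIER**: `Σ_{x,y∈S} f(x)·K_b(x−y)·g(y) = (2π)^{−(d+1)}·∫_{BZ} b(s)·conj f̃(s)·g̃(s) ds`. -/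
theorem form_scalar_eq_integral (S : Finset (X (d + 1))) (f g : X (d + 1) → ℝ) (b : (Fin (d + 1) → ℂ) → ℂ)
    (hb : IntegrableOn (fun p => b (ofRealVec p)) (BZ (d + 1))) :
    ∑ x ∈ S, ∑ y ∈ S, (f x : ℂ) * latticeKernel b (x - y) * (g y : ℂ) =
      ((((2 * Real.pi) ^ (d + 1))⁻¹ : ℝ) : ℂ) * ∫ s in BZ (d + 1), b (ofRealVec s) * (conj (FT S f s) * FT S g s) := by
  have h1 : ∀ x y, (f x : ℂ) * latticeKernel b (x - y) * (g y : ℂ) =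
      ((((2 * Real.pi) ^ (d + 1))⁻¹ : ℝ) : ℂ) * ∫ s in BZ (d + 1), ((f x * g y : ℝ) : ℂ) * integrand b (x - y) s := by
    intro x y
    rw [integral_const_mul]
    unfold latticeKernel fourierBox
    rw [Complex.real_smul]
    push_cast
    ring
  have hF : ∀ x y, IntegrableOn (fun s => ((f x * g y : ℝ) : ℂ) * integrand b (x - y) s) (BZ (d + 1)) :=
    fun x y => (integrableOn_integrand_of_integrableOn hb (x - y)).const_mul _
  simp_rw [h1]
  simp only [← Finset.mul_sum]
  have h2 : ∀ x, Integrable (fun s => ∑ y ∈ S, ((f x * g y : ℝ) : ℂ) * integrand b (x - y) s) (volume.restrict (BZ (d + 1))) :=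
    fun x => integrable_finsetSum _ fun y _ => hF x y
  rw [← setIntegral_congr_fun measurableSet_BZ (fun s _ => sum_integrand_scalar_eq S f g b s),
    integral_finsetSum _ fun x _ => h2 x]
  congr 1
  refine Finset.sum_congr rfl fun x _ => ?_
  rw [integral_finsetSum _ fun y _ => hF x y]

/-! ## §3 The form on forward differences -/

/-- [folklore] **PARSEVAL FOR THE COARSE GRADIENT FORM**: for a real `φ` supported in `S`, a window `T ⊇ S` with `S − e_μ ⊆ T` for every `μ`, and a matrix
multiplier `A` with zone-integrable entries,
`Σ_{x,y∈T} Σ_{μν} (φ(x+e_μ) − φ(x))·K_{A_{μν}}(x−y)·(φ(y+e_ν) − φ(y)) = (2π)^{−(d+1)}·∫_{BZ} ‖φ̃(s)‖²·quad (A(s)) (d1Sym s) ds`. -/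
theorem form_diff_eq_integral {S T : Finset (X (d + 1))} {φ : X (d + 1) → ℝ} (hS : ∀ y ∉ S, φ y = 0) (hST : S ⊆ T)
    (hTe : ∀ μ, ∀ y ∈ S, y - e μ ∈ T) (A : (Fin (d + 1) → ℂ) → Matrix (Fin (d + 1)) (Fin (d + 1)) ℂ)
    (hA : ∀ α β, IntegrableOn (fun p => A (ofRealVec p) α β) (BZ (d + 1))) :
    ∑ x ∈ T, ∑ y ∈ T, ∑ μ, ∑ ν, ((φ (x + e μ) - φ x : ℝ) : ℂ) * latticeKernel (fun p => A p μ ν) (x - y) * ((φ (y + e ν) - φ y : ℝ) : ℂ) =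
      ((((2 * Real.pi) ^ (d + 1))⁻¹ : ℝ) : ℂ) * ∫ s in BZ (d + 1), ((‖FT T φ s‖ ^ 2 : ℝ) : ℂ) * quad (A (ofRealVec s)) (d1Sym s) := by
  rw [form_latticeKernel_eq_integral T (fun x μ => φ (x + e μ) - φ x) A hA]
  congr 1
  refine setIntegral_congr_fun measurableSet_BZ fun s _ => ?_
  have h : (fun β => FT T (fun y => φ (y + e β) - φ y) s) = fun β => FT T φ s * d1Sym s β := by
    funext β
    rw [← d1Sym_mul_FT hS hST β (hTe β) s, mul_comm]
  simp only [h]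
  exact quad_mul_left _ _ _

/-! ## §4 Real parts and the monotonicity principle -/

/-- [folklore] The window transform is continuous in the momentum. -/
theorem continuous_FT (T : Finset (X (d + 1))) (φ : X (d + 1) → ℝ) : Continuous fun s : Fin (d + 1) → ℝ => FT T φ s := by
  unfold FT
  refine continuous_finsetSum _ fun y _ => continuous_const.mul (Complex.continuous_exp.comp ?_)
  exact (Complex.continuous_ofReal.comp (continuous_phase y).neg).mul continuous_const

/-- [folklore] REAL SCALAR FORM: `Σ_{x,y∈S} φ(x)·Re K_b(x−y)·φ(y) = (2π)^{−(d+1)}·∫_{BZ} Re b(s)·‖φ̃(s)‖² ds`. -/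
theorem re_form_scalar_eq_integral (S : Finset (X (d + 1))) (φ : X (d + 1) → ℝ) (b : (Fin (d + 1) → ℂ) → ℂ)
    (hb : IntegrableOn (fun p => b (ofRealVec p)) (BZ (d + 1))) :
    ∑ x ∈ S, ∑ y ∈ S, φ x * (latticeKernel b (x - y)).re * φ y =
      ((2 * Real.pi) ^ (d + 1))⁻¹ * ∫ s in BZ (d + 1), (b (ofRealVec s)).re * ‖FT S φ s‖ ^ 2 := by
  have h := congrArg Complex.re (form_scalar_eq_integral S φ φ b hb)
  simp only [Complex.re_sum, Complex.mul_re, Complex.ofReal_re, Complex.ofReal_im, zero_mul, sub_zero, mul_zero] at h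
  rw [h]
  have hint : Integrable (fun s => b (ofRealVec s) * (conj (FT S φ s) * FT S φ s)) (volume.restrict (BZ (d + 1))) := by
    have hc : Continuous fun s : Fin (d + 1) → ℝ => conj (FT S φ s) * FT S φ s :=
      (Complex.continuous_conj.comp (continuous_FT S φ)).mul (continuous_FT S φ)
    exact hb.mul_continuousOn hc.continuousOn isCompact_BZ
  have hre := integral_re hint
  simp only [RCLike.re_to_complex] at hre
  rw [← hre]
  congr 1
  refine integral_congr_ae (Filter.Eventually.of_forall fun s => ?_)
  simp only []
  rw [Complex.conj_mul' (FT S φ s), ← Complex.ofReal_pow, Complex.mul_re, Complex.ofReal_re, Complex.ofReal_im]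
  ring

/-- [folklore] REAL GRADIENT FORM: `Σ_{x,y∈T} Σ_{μν} (d^cφ)(x,μ)·Re K_{A_{μν}}(x−y)·(d^cφ)(y,ν) = (2π)^{−(d+1)}·∫_{BZ} ‖φ̃(s)‖²·Re quad (A(s)) (d1Sym s) ds`. -/
theorem re_form_diff_eq_integral {S T : Finset (X (d + 1))} {φ : X (d + 1) → ℝ} (hS : ∀ y ∉ S, φ y = 0) (hST : S ⊆ T)
    (hTe : ∀ μ, ∀ y ∈ S, y - e μ ∈ T) (A : (Fin (d + 1) → ℂ) → Matrix (Fin (d + 1)) (Fin (d + 1)) ℂ)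
    (hA : ∀ α β, IntegrableOn (fun p => A (ofRealVec p) α β) (BZ (d + 1)))
    (hq : IntegrableOn (fun s => quad (A (ofRealVec s)) (d1Sym s)) (BZ (d + 1))) :
    ∑ x ∈ T, ∑ y ∈ T, ∑ μ, ∑ ν, (φ (x + e μ) - φ x) * (latticeKernel (fun p => A p μ ν) (x - y)).re * (φ (y + e ν) - φ y) =
      ((2 * Real.pi) ^ (d + 1))⁻¹ * ∫ s in BZ (d + 1), ‖FT T φ s‖ ^ 2 * (quad (A (ofRealVec s)) (d1Sym s)).re := by
  have h := congrArg Complex.re (form_diff_eq_integral hS hST hTe A hA)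
  simp only [Complex.re_sum, Complex.mul_re, Complex.ofReal_re, Complex.ofReal_im, zero_mul, sub_zero, mul_zero] at h
  rw [h]
  have hint : Integrable (fun s => ((‖FT T φ s‖ ^ 2 : ℝ) : ℂ) * quad (A (ofRealVec s)) (d1Sym s)) (volume.restrict (BZ (d + 1))) := by
    have hc : Continuous fun s : Fin (d + 1) → ℝ => ((‖FT T φ s‖ ^ 2 : ℝ) : ℂ) :=
      Complex.continuous_ofReal.comp ((continuous_FT T φ).norm.pow 2)
    exact hq.continuousOn_mul hc.continuousOn isCompact_BZ
  have hre := integral_re hint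
  simp only [RCLike.re_to_complex] at hre
  rw [← hre]
  congr 1
  refine integral_congr_ae (Filter.Eventually.of_forall fun s => ?_)
  simp only [Complex.mul_re, Complex.ofReal_re, Complex.ofReal_im, zero_mul, sub_zero]

/-- [folklore] **THE MONOTONICITY PRINCIPLE «SYMBOL INEQUALITY ⟹ FORM INEQUALITY»**: if `c·Re b(s) ≤ Re quad (A(s)) (d1Sym s)` for every
`s ∈ BZ ∖ {0}` (a null set is free), then for every real `φ` supported in `S` (window `T` as above)
`c·Σ_{x,y∈T} φ(x)·Re K_b(x−y)·φ(y) ≤ Σ_{x,y∈T} Σ_{μν} (φ(x+e_μ) − φ(x))·Re K_{A_{μν}}(x−y)·(φ(y+e_ν) − φ(y))`. -/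
theorem form_diff_ge_of_symbol {S T : Finset (X (d + 1))} {φ : X (d + 1) → ℝ} (hS : ∀ y ∉ S, φ y = 0) (hST : S ⊆ T)
    (hTe : ∀ μ, ∀ y ∈ S, y - e μ ∈ T) {A : (Fin (d + 1) → ℂ) → Matrix (Fin (d + 1)) (Fin (d + 1)) ℂ} {b : (Fin (d + 1) → ℂ) → ℂ} {c : ℝ}
    (hA : ∀ α β, IntegrableOn (fun p => A (ofRealVec p) α β) (BZ (d + 1)))
    (hq : IntegrableOn (fun s => quad (A (ofRealVec s)) (d1Sym s)) (BZ (d + 1)))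
    (hb : IntegrableOn (fun p => b (ofRealVec p)) (BZ (d + 1)))
    (hpt : ∀ s ∈ BZ (d + 1), s ≠ 0 → c * (b (ofRealVec s)).re ≤ (quad (A (ofRealVec s)) (d1Sym s)).re) :
    c * ∑ x ∈ T, ∑ y ∈ T, φ x * (latticeKernel b (x - y)).re * φ y ≤
      ∑ x ∈ T, ∑ y ∈ T, ∑ μ, ∑ ν, (φ (x + e μ) - φ x) * (latticeKernel (fun p => A p μ ν) (x - y)).re * (φ (y + e ν) - φ y) := by
  rw [re_form_scalar_eq_integral T φ b hb, re_form_diff_eq_integral hS hST hTe A hA hq, ← mul_assoc, mul_comm c, mul_assoc,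
    ← integral_const_mul]
  refine mul_le_mul_of_nonneg_left ?_ (by positivity)
  have hcFT : Continuous fun s : Fin (d + 1) → ℝ => ‖FT T φ s‖ ^ 2 := (continuous_FT T φ).norm.pow 2
  have hbre : IntegrableOn (fun s => (b (ofRealVec s)).re) (BZ (d + 1)) := hb.re
  have hqre : IntegrableOn (fun s => (quad (A (ofRealVec s)) (d1Sym s)).re) (BZ (d + 1)) := hq.re
  have hi1 : Integrable (fun s => c * ((b (ofRealVec s)).re * ‖FT T φ s‖ ^ 2)) (volume.restrict (BZ (d + 1))) :=
    ((hbre.mul_continuousOn hcFT.continuousOn isCompact_BZ)).const_mul c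
  have hi2 : Integrable (fun s => ‖FT T φ s‖ ^ 2 * (quad (A (ofRealVec s)) (d1Sym s)).re) (volume.restrict (BZ (d + 1))) :=
    hqre.continuousOn_mul hcFT.continuousOn isCompact_BZ
  refine integral_mono_ae hi1 hi2 ?_
  -- off the null set `{0}` the pointwise inequality holds on the zone
  have h0 : ∀ᵐ s ∂(volume.restrict (BZ (d + 1))), s ≠ (0 : Fin (d + 1) → ℝ) := by
    have : (volume.restrict (BZ (d + 1))) {(0 : Fin (d + 1) → ℝ)} = 0 := by
      rw [Measure.restrict_apply (measurableSet_singleton _)]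
      exact measure_mono_null Set.inter_subset_left (measure_singleton _)
    filter_upwards [compl_mem_ae_iff.2 this] with s hs
    simpa using hs
  have hBZ : ∀ᵐ s ∂(volume.restrict (BZ (d + 1))), s ∈ BZ (d + 1) := ae_restrict_mem measurableSet_BZ
  filter_upwards [h0, hBZ] with s hs0 hsBZ
  have h := hpt s hsBZ hs0
  have hF : 0 ≤ ‖FT T φ s‖ ^ 2 := by positivity
  calc c * ((b (ofRealVec s)).re * ‖FT T φ s‖ ^ 2) = (c * (b (ofRealVec s)).re) * ‖FT T φ s‖ ^ 2 := by ring
    _ ≤ (quad (A (ofRealVec s)) (d1Sym s)).re * ‖FT T φ s‖ ^ 2 := mul_le_mul_of_nonneg_right h hF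
    _ = ‖FT T φ s‖ ^ 2 * (quad (A (ofRealVec s)) (d1Sym s)).re := mul_comm _ _

end Summit.QuantumFields.BalabanUV.Beta.FP.LatticeFormPlancherel

end
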